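/-
Lead `ym-line-sgb-p2` (gen 1, seat prover-ym-line-sgb-p2-g1-0), route `SteinGapBootstrap`, crux item
stmt-QuantumFields-23800 `UProbeCovFromPairLaw` ≡ stmt-QuantumFields-23640 `ProbeCovFromPairLawG`, line `direct`,
STUB `stub_gaussSide` (the Gaussian side: the probe covariance under the block law).
-/
import Summits.QuantumFields.YangMills.Theorems.EquipartitionCriticalityEquipartitionPinsProbeGaussianProfile
import Literature.MathematicalPhysics.QuantumFieldTheory.LatticeMaxwellBlockOU
import HarnessLib

/-!
# Route `SteinGapBootstrap`, crux `UProbeCovFromPairLaw` (stmt-QuantumFields-23800 ≡ `ProbeCovFromPairLawG` 23640),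
# line `direct`: STUB `stub_gaussSide` — the Gaussian side

NOT THE CLAY GAP: the route bears on the RECORD-label rung leaf R2ξ′ `WeakCouplingRates.XiPow`; this file is a
transport of a landed Gaussian computation and proves no summit statement.

Under the lattice-Maxwell block law `γ_B = latticeMaxwellBlockLaw B D` (the image of `curvatureGaussianField 4 D`
under restriction to the block `B`, `integral_latticeMaxwellBlockLaw`) the covariance of the Gaussian probes
`e^{−|z_p|²}`, `e^{−|z_q|²}` (`p, q ∈ B`) is `2^{−D}((1 − c²)^{−D/2} − 1)` with `c = curvatureTwoPoint p q` — the tree's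
`EquipartitionPinsProbe.GaussianProfile.covariance_formula` read through the restriction map.

References: C. Garban, A. Sepúlveda, arXiv:2107.04021 §4 (law of the gradient spin-wave) [GarbanSepulveda2023];
S. Chatterjee, arXiv:1602.01222 §11 [arXiv160201222].
-/

set_option autoImplicit false

noncomputable section

namespace Summit.QuantumFields.YangMills.Theorems.SteinGapBootstrap

namespace ProbeCovDirect

open MeasureTheory
open Literature.MathematicalPhysics.QuantumLattice Literature.MathematicalPhysics.QuantumFieldTheory
open Summit.QuantumFields.YangMills.Theorems.EquipartitionPinsProbe

/-- The Gaussian probe `z ↦ exp(−Σ_a (z_p^a)²)` on the block space is continuous. [folklore] -/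
theorem continuous_blockGauss {D : ℕ} (B : Finset (Literature.MathematicalPhysics.QuantumLattice.ZdPlaquette 4))
    (p : ↥B) : Continuous fun z : ↥B → Fin D → ℝ => Real.exp (-(∑ a : Fin D, (z p a) ^ 2)) :=
  Real.continuous_exp.comp (continuous_finsetSum _ fun a _ =>
    ((continuous_apply a).comp (continuous_apply p)).pow 2).neg

/-- STUB `stub_gaussSide` of line `direct` (crux stmt-QuantumFields-23800 ≡ 23640) — **the Gaussian side**: under the
block law `γ_B = latticeMaxwellBlockLaw B D` the covariance of `e^{−|z_p|²}` and `e^{−|z_q|²}` is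
`2^{−D}((1 − c²)^{−D/2} − 1)` with `c = curvatureTwoPoint p q` (`GaussianProfile.covariance_formula` transported by
`integral_latticeMaxwellBlockLaw`). -/
theorem stub_gaussSide :
    ∀ (B : Finset (Literature.MathematicalPhysics.QuantumLattice.ZdPlaquette 4)) (D : ℕ) (p q : ↥B),
      (∫ z, Real.exp (-(∑ a : Fin D, (z p a) ^ 2)) * Real.exp (-(∑ a : Fin D, (z q a) ^ 2))
          ∂(Literature.MathematicalPhysics.QuantumFieldTheory.latticeMaxwellBlockLaw B D)) -
        (∫ z, Real.exp (-(∑ a : Fin D, (z p a) ^ 2))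
          ∂(Literature.MathematicalPhysics.QuantumFieldTheory.latticeMaxwellBlockLaw B D)) *
        (∫ z, Real.exp (-(∑ a : Fin D, (z q a) ^ 2))
          ∂(Literature.MathematicalPhysics.QuantumFieldTheory.latticeMaxwellBlockLaw B D)) =
      (2 : ℝ) ^ (-(D : ℝ)) *
        ((1 - (Literature.MathematicalPhysics.QuantumFieldTheory.curvatureTwoPoint (d := 4)
          (p : Literature.MathematicalPhysics.QuantumLattice.ZdPlaquette 4) q) ^ 2) ^ (-((D : ℝ) / 2)) - 1) := by
  intro B D p q
  have h2 : AEStronglyMeasurable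
      (fun z : ↥B → Fin D → ℝ => Real.exp (-(∑ a : Fin D, (z p a) ^ 2)) * Real.exp (-(∑ a : Fin D, (z q a) ^ 2)))
      (latticeMaxwellBlockLaw B D) :=
    (Continuous.aestronglyMeasurable ((continuous_blockGauss B p).mul (continuous_blockGauss B q)))
  rw [integral_latticeMaxwellBlockLaw B D _ h2,
    integral_latticeMaxwellBlockLaw B D _ (continuous_blockGauss B p).aestronglyMeasurable,
    integral_latticeMaxwellBlockLaw B D _ (continuous_blockGauss B q).aestronglyMeasurable]
  exact GaussianProfile.covariance_formula D p q

end ProbeCovDirect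

end Summit.QuantumFields.YangMills.Theorems.SteinGapBootstrap

end
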